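import Summits.RiemannHypothesis.RiemannHypothesis.Theorems.SemilocalNegCert
import HarnessLib

/-!
# Semi-local threshold at the archimedean place alone, negative side: `WeilNegCert0` and `a*(∅) ≤ 3/8` by a cubic

Cell `rh-explicit` (HOME `run/shared/lean/pub/rh-explicit/`), seat cc-s2-5 (A4 SEMILOCAL-TABLE, rows `{∞}`, `{∞,3}`,
`{∞,5}`, `{∞,3,5}`).  Honest framing: theorems about the tree's `weilSemilocalThreshold S` for the sets `S ∌ 2`
(consolation side of the motivic door: WHERE the `S`-truncated positivity of the Connes–Consani programme stops);
nothing here bears on RH.  No data is trusted: soundness consumes only `c.check c₀ = true`.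

For `S = ∅` the semi-local form has NO prime term at all (`weilSemilocalPrimeTerm_empty`), so the `{∞,2}` Markov
decomposition of lad-2 (`re_weilSemilocalQuadratic_two_eq`) loses its jump term:

  `Re Q_∅(g) = P(g) + ∫₀^∞ w(t) D_t(g) dt − C_∅ ‖g‖₂²`,  `C_∅ = C₂ − √2·log 2 = log 4π + γ + π/2 + log 2 = 5.3721…`

(`re_weilSemilocalQuadratic_empty_eq`, derived from the `{2}` identity on windows `a ≤ log 2`, which is all the
certificates need).  The mollifier criterion with polar credit (`IsMarkovWitness.not_weilSemilocalPositivityOn_empty_polar`)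
and the certificate `WeilNegCert0 = (p, b; nA, mA, KA; Kt, nt; ne)` with its `ℚ`-checker are the `{2}` ones
(`SemilocalNegCert.lean`, cc-s2-4) with the `U_{log 2}` term deleted; SOUNDNESS:
`check c c₀ = true → c₀ ≤ C_∅ → weilSemilocalThreshold ∅ ≤ c.b`.

INSTANCE (the simplest refuting object of the A4 table, lineage B of cc-s2-5, two exact engines agree to 24 digits
on `Re Q_∅(G)/‖G‖² = −8.9353…·10⁻³`): the CUBIC `G(x) = ((43ξ − 35ξ³)/2)·1_{[−b,b]}`, `ξ = x/b`, `b = 3/8` ⇒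
`weilSemilocalThreshold ∅ ≤ 3/8` (`weilSemilocalThreshold_empty_le_three_eighths`), hence by locality
(`weilSemilocalThreshold_congr` at `N = 2`, since `3/8 < (log 3)/2`) **`a*(S) = a*(∅) ≤ 3/8` for EVERY finite `S ∌ 2`**
— the rows `{∞}`, `{∞,3}`, `{∞,5}`, `{∞,3,5}` of `HOME/SEMILOCAL-TABLE.md`, whose lower end `(log 2)/2 ≤ a*(S)` is
`log_two_half_le_weilSemilocalThreshold`.  Folklore throughout.
-/

set_option autoImplicit false
set_option linter.dupNamespace false  -- the mandated namespace repeats `RiemannHypothesis`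

noncomputable section

open Complex Filter Set MeasureTheory Topology
open scoped Real

namespace Summit.RiemannHypothesis.RiemannHypothesis.Theorems.MotivicDoor.SemilocalMarkov

open Literature.NumberTheory.LFunctions Literature.NumberTheory.LFunctions.WeilContinuous
open Summit.RiemannHypothesis.RiemannHypothesis.Theorems.MotivicDoor.SemilocalThreshold

/-! ## The `S = ∅` Markov decomposition -/

/-- The killing constant of the pure archimedean form: `C_∅ = C₂ − 2(log 2/√2)` (`= log 4π + γ + π/2 + log 2`). -/
def semilocalEmptyConstant : ℝ := semilocalTwoConstant - 2 * (Real.log 2 / Real.sqrt 2)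

/-- `Λ_∅(n)/√n = 0` for every `n`: no prime power is `∅`-smooth. -/
theorem weilSemilocalCoeff_empty (n : ℕ) : weilSemilocalCoeff ∅ n = 0 := by
  unfold weilSemilocalCoeff
  split_ifs with h
  · have h0 : n.primeFactors = ∅ := Finset.subset_empty.1 h
    rcases Nat.primeFactors_eq_empty.1 h0 with rfl | rfl <;> simp
  · rfl

/-- The `∅`-prime term vanishes identically. -/
theorem weilSemilocalPrimeTerm_empty (k : ℝ → ℂ) : weilSemilocalPrimeTerm ∅ k = 0 := by
  unfold weilSemilocalPrimeTerm
  simp [weilSemilocalCoeff_empty]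

/-- `Q_∅(g) = Q_{{2}}(g) + (the `{2}`-prime term of `g ⋆ g̃`)`. -/
theorem weilSemilocalQuadratic_empty_eq_two_add (g : ℝ → ℂ) :
    weilSemilocalQuadratic ∅ g =
      weilSemilocalQuadratic {2} g + weilSemilocalPrimeTerm {2} (weilConv g (weilReflect g)) := by
  unfold weilSemilocalQuadratic weilSemilocalFunctional
  rw [weilSemilocalPrimeTerm_empty]
  ring

variable {g : ℝ → ℂ} {a : ℝ}

/-- **The `S = ∅` Markov decomposition** (pure archimedean + polar form).  For a test function `g` with
`tsupport g ⊆ [-a,a]`, `a ≤ log 2`: `Re Q_∅(g) = P(g) + ∫₀^∞ w D(g) − C_∅ ‖g‖₂²`. -/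
theorem re_weilSemilocalQuadratic_empty_eq (hg : IsWeilTest g) (hsupp : tsupport g ⊆ Icc (-a) a)
    (ha : a ≤ Real.log 2) :
    (weilSemilocalQuadratic ∅ g).re =
      weilPoleForm g + (∫ t in Ioi (0 : ℝ), weilArchDensity t * weilIncrement g t) -
        semilocalEmptyConstant * ∫ x : ℝ, ‖g x‖ ^ 2 := by
  rw [weilSemilocalQuadratic_empty_eq_two_add, Complex.add_re, re_weilSemilocalQuadratic_two_eq hg hsupp ha,
    weilSemilocalPrimeTerm_two_eq hg hsupp ha, Complex.ofReal_re]
  unfold semilocalEmptyConstant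
  ring

/-! ## The negativity criterion with polar credit, `S = ∅` -/

namespace IsMarkovWitness

variable {G : ℝ → ℂ} {b M : ℝ} (hW : IsMarkovWitness G b M)
include hW

/-- **Negativity of the `∅` form from a Markov witness, polar term included.**  If a bounded measurable odd
a.e.-continuous `G` vanishing off `[-b, b]` has finite archimedean energy and
`∫₀^∞ w D(G) < C_∅ ‖G‖₂² + 2|Ĝ(1)|²`, then `∅`-Weil positivity fails on every cone `C(B)` with `b < B ≤ log 2`
(witnesses: the mollifications `G ⋆ φ_k`). -/
theorem not_weilSemilocalPositivityOn_empty_polar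
    (hfin : IntegrableOn (fun t ↦ weilArchDensity t * weilIncrement G t) (Ioi 0))
    (hlt : (∫ t in Ioi (0 : ℝ), weilArchDensity t * weilIncrement G t) <
      semilocalEmptyConstant * (∫ x, ‖G x‖ ^ 2) + 2 * ‖weilMellin G 1‖ ^ 2)
    {B : ℝ} (hbB : b < B) (hB : B ≤ Real.log 2) : ¬ WeilSemilocalPositivityOn ∅ B := by
  intro hpos
  set U := ∫ t in Ioi (0 : ℝ), weilArchDensity t * weilIncrement G t with hU
  have hk : ∀ᶠ k : ℕ in atTop, b + (bump k).rOut < B := by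
    have h : Tendsto (fun k ↦ b + (bump k).rOut) atTop (𝓝 (b + 0)) :=
      tendsto_const_nhds.add tendsto_bump_rOut
    rw [add_zero] at h
    exact (tendsto_order.1 h).2 B hbB
  have hle : ∀ᶠ k : ℕ in atTop, semilocalEmptyConstant * (∫ x, ‖weilConv G (moll k) x‖ ^ 2)
      + 2 * (‖weilMellin G 1‖ ^ 2 * ‖weilMellin (moll k) 1‖ ^ 2) ≤ U := by
    filter_upwards [hk] with k hk
    have hg := hW.isWeilTest_weilConv_moll k
    have hsupp : tsupport (weilConv G (moll k)) ⊆ Icc (-B) B :=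
      (hW.tsupport_weilConv_moll_subset k).trans (Icc_subset_Icc (by linarith) hk.le)
    have h0 := hpos _ hg hsupp
    rw [re_weilSemilocalQuadratic_empty_eq hg hsupp hB, hW.weilPoleForm_weilConv_moll k] at h0
    have hD2 : ∫ t in Ioi (0 : ℝ), weilArchDensity t * weilIncrement (weilConv G (moll k)) t ≤
        ∫ t in Ioi (0 : ℝ), weilArchDensity t * weilIncrement G t :=
      setIntegral_mono_on (integrableOn_weilArchDensity_mul_weilIncrement hg) hfin measurableSet_Ioi
        (fun t ht ↦ mul_le_mul_of_nonneg_left (hW.weilIncrement_weilConv_moll_le k t)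
          (weilArchDensity_pos ht).le)
    linarith
  have hlim : Tendsto (fun k : ℕ ↦ semilocalEmptyConstant * (∫ x, ‖weilConv G (moll k) x‖ ^ 2)
      + 2 * (‖weilMellin G 1‖ ^ 2 * ‖weilMellin (moll k) 1‖ ^ 2)) atTop
      (𝓝 (semilocalEmptyConstant * (∫ x, ‖G x‖ ^ 2) + 2 * (‖weilMellin G 1‖ ^ 2 * ‖(1 : ℂ)‖ ^ 2))) :=
    (hW.tendsto_integral_norm_sq_weilConv_moll.const_mul _).add
      ((((tendsto_weilMellin_moll 1).norm.pow 2).const_mul _).const_mul _)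
  rw [norm_one, one_pow, mul_one] at hlim
  have := le_of_tendsto hlim hle
  linarith

end IsMarkovWitness

/-- **Bridge (B−) for `S = ∅`.** A Markov witness on `[−b, b]`, `b < log 2`, satisfying the `∅` criterion gives
`a*(∅) ≤ b`. -/
theorem weilSemilocalThreshold_empty_le_of_markovWitness {G : ℝ → ℂ} {b M : ℝ}
    (hW : IsMarkovWitness G b M)
    (hfin : IntegrableOn (fun t ↦ weilArchDensity t * weilIncrement G t) (Ioi 0))
    (hlt : (∫ t in Ioi (0 : ℝ), weilArchDensity t * weilIncrement G t) <
      semilocalEmptyConstant * (∫ x, ‖G x‖ ^ 2) + 2 * ‖weilMellin G 1‖ ^ 2)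
    (hb : b < Real.log 2) : weilSemilocalThreshold ∅ ≤ b := by
  by_contra h
  have hlt' : b < min (weilSemilocalThreshold ∅) (Real.log 2) := lt_min (lt_of_not_ge h) hb
  exact hW.not_weilSemilocalPositivityOn_empty_polar hfin hlt hlt' (min_le_right _ _)
    ((weilSemilocalPositivityOn_weilSemilocalThreshold ∅).mono (min_le_left _ _))

end Summit.RiemannHypothesis.RiemannHypothesis.Theorems.MotivicDoor.SemilocalMarkov

/-! ## The certificate `WeilNegCert0`, its checker, soundness -/

namespace Summit.RiemannHypothesis.RiemannHypothesis.Theorems.SemilocalPolyWitness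

open MeasureTheory Set Finset Real
open Literature.NumberTheory.LFunctions
open Summit.RiemannHypothesis.RiemannHypothesis.Theorems.MotivicDoor
open Summit.RiemannHypothesis.RiemannHypothesis.Theorems.MotivicDoor.SemilocalThreshold
open LQ

/-- `√2 ≤ 1.4142135623730950489`. -/
def sqrtTwoHi : ℚ := 14142135623730950489 / 10000000000000000000

/-- `√2 ≤ sqrtTwoHi`. -/
theorem sqrt_two_le_sqrtTwoHi : Real.sqrt 2 ≤ (sqrtTwoHi : ℝ) := by
  have h0 : (0 : ℝ) ≤ sqrtTwoHi := by rw [sqrtTwoHi]; norm_num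
  rw [show (sqrtTwoHi : ℝ) = Real.sqrt ((sqrtTwoHi : ℝ) ^ 2) from (Real.sqrt_sq h0).symm]
  exact Real.sqrt_le_sqrt (by rw [sqrtTwoHi]; norm_num)

/-- A rational lower bound of `C_∅ = C₂ − √2 log 2`: `c0SharpQ = c2SharpQ − sqrtTwoHi·logTwoHi20` (`≈ 5.37209…`). -/
def c0SharpQ : ℚ := c2SharpQ - sqrtTwoHi * logTwoHi20

/-- `c0SharpQ ≤ C_∅`. -/
theorem c0SharpQ_le : (c0SharpQ : ℝ) ≤ SemilocalMarkov.semilocalEmptyConstant := by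
  have h1 := c2SharpQ_le
  have h2 : 2 * (Real.log 2 / Real.sqrt 2) = Real.sqrt 2 * Real.log 2 := by
    have hs : Real.sqrt 2 * Real.sqrt 2 = 2 := Real.mul_self_sqrt (by norm_num)
    have hs0 : Real.sqrt 2 ≠ 0 := by positivity
    field_simp
    nlinarith [hs]
  have h3 : Real.sqrt 2 * Real.log 2 ≤ (sqrtTwoHi : ℝ) * logTwoHi20 :=
    mul_le_mul sqrt_two_le_sqrtTwoHi log_two_le_logTwoHi20 (Real.log_pos one_lt_two).le
      (by rw [sqrtTwoHi]; norm_num)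
  unfold SemilocalMarkov.semilocalEmptyConstant
  rw [h2, c0SharpQ]
  push_cast
  linarith

/-- A negative certificate for the `∅` threshold: an odd polynomial witness and enclosure orders
(= `WeilNegCert2` without the atom at `log 2`). -/
structure WeilNegCert0 where
  /-- coefficients (in powers of `x`) of the odd polynomial `p`; the witness is `p·1_{[−b,b]}` -/
  p : List ℚ
  /-- the window half-width (`a*(∅) ≤ b` is the conclusion) -/
  b : ℚ
  /-- order of the `exp` majorant in `archMajorL` (`≥ 1`) -/
  nA : ℕ
  /-- half the number of geometric terms in `archMajorL` -/
  mA : ℕ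
  /-- order of the `sinh` minorant in `archMajorL` -/
  KA : ℕ
  /-- number of explicit tail exponentials -/
  Kt : ℕ
  /-- order of the partial `exp` sums bounding `e^{−x}` (`≥ 1`) -/
  nt : ℕ
  /-- order of the Maclaurin polynomial in the polar moment (`≥ 1`) -/
  ne : ℕ

namespace WeilNegCert0

variable (c : WeilNegCert0)

/-- `q = D/t` as a list (the increment list without its vanishing constant coefficient). -/
def q : List ℚ := (incrementL c.p c.b).tail

/-- Upper bound of the archimedean energy `∫₀^∞ w·D` (bulk majorant + tail). -/
def lhsQ : ℚ :=
  evQ (integ (mul (archMajorL c.nA c.mA c.KA) c.q)) (2 * c.b)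
    + 2 * LQ.normSq c.p c.b * archTailQ (2 * c.b) c.Kt c.nt

/-- Lower bound of the right side `C_∅‖G‖² + 2|Ĝ(1)|²`, given a lower bound `c₀ ≤ C_∅`. -/
def rhsQ (c0 : ℚ) : ℚ := c0 * LQ.normSq c.p c.b + 2 * mellinOneLowerQ c.p c.b c.ne ^ 2

/-- **The checker.** -/
def check (c0 : ℚ) : Bool :=
  isOddList c.p && decide (0 < c.b) && decide (c.b ≤ 1) && decide (c.b < logTwoLo20) &&
    decide (0 < c.nA) && decide (0 < c.nt) && decide (0 < c.ne) &&
    decide ((incrementL c.p c.b).headD 0 = 0) && decide (invPartialExpQ c.nt (2 * (2 * c.b)) < 1) &&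
    decide (0 ≤ c0) && decide (c.lhsQ < c.rhsQ c0)

end WeilNegCert0

/-- **SOUNDNESS of `WeilNegCert0`.**  If the checker accepts `c` against a proved lower bound `c₀ ≤ C_∅`, then
`a*(∅) ≤ c.b`. -/
theorem weilSemilocalThreshold_empty_le_of_check (c : WeilNegCert0) {c0 : ℚ}
    (hc0 : (c0 : ℝ) ≤ SemilocalMarkov.semilocalEmptyConstant) (h : c.check c0 = true) :
    weilSemilocalThreshold ∅ ≤ (c.b : ℝ) := by
  -- unpack the checker
  simp only [WeilNegCert0.check, Bool.and_eq_true, decide_eq_true_eq] at h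
  obtain ⟨⟨⟨⟨⟨⟨⟨⟨⟨⟨hodd, hb0⟩, hb1⟩, hblog⟩, hnA⟩, hnt⟩, hne⟩, hhead⟩, htail1⟩, hc00⟩, hmain⟩ := h
  set p := c.p
  set b := c.b
  have hb0' : (0 : ℝ) < b := by exact_mod_cast hb0
  have hb2' : ((2 * b : ℚ) : ℝ) ≤ 2 := by
    have h2 : 2 * b ≤ (2 : ℚ) := by linarith
    exact_mod_cast h2
  have hblt : (b : ℝ) < Real.log 2 := lt_of_lt_of_le (by exact_mod_cast hblog) logTwoLo20_le
  set G := polyWitness p b with hG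
  have hW := isMarkovWitness_polyWitness (p := p) (b := b) hodd hb0
  set inc := incrementL p b
  set N : ℝ := (LQ.normSq p b : ℝ)
  have hN : ∫ x, ‖G x‖ ^ 2 = N := integral_norm_sq_polyWitness (p := p) hb0
  have hN0 : 0 ≤ N := by rw [← hN]; exact integral_nonneg fun x ↦ by positivity
  -- D on (0, 2b]: D(t) = ev inc t = t · ev q t, q ≥ 0
  have hDev : ∀ t ∈ Set.Ioc (0 : ℝ) ((2 * b : ℚ) : ℝ), weilIncrement G t = ev inc t := fun t ht ↦
    weilIncrement_polyWitness_eq_ev hodd hb0 ht.1.le (by push_cast at ht; exact ht.2)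
  have hDq : ∀ t ∈ Set.Ioc (0 : ℝ) ((2 * b : ℚ) : ℝ), weilIncrement G t = t * ev c.q t := fun t ht ↦ by
    rw [hDev t ht, ev_eq_headD_add_tail, hhead]
    push_cast
    rw [zero_add]
    rfl
  have hq : ∀ t ∈ Set.Ioc (0 : ℝ) ((2 * b : ℚ) : ℝ), 0 ≤ ev c.q t := fun t ht ↦ by
    have h1 := weilIncrement_nonneg G t
    rw [hDq t ht] at h1
    exact (mul_nonneg_iff_of_pos_left ht.1).1 h1
  -- bulk
  obtain ⟨hintA, hA⟩ := setIntegral_weilArchDensity_mul_le (D := weilIncrement G) (by positivity) hb2' hDq hq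
    c.nA c.mA c.KA hnA
  -- tail
  have h2b0 : (0 : ℚ) < 2 * b := by positivity
  obtain ⟨hintW, _⟩ := setIntegral_Ioi_weilArchDensity_le c.Kt (c := ((2 * b : ℚ) : ℝ)) (by exact_mod_cast h2b0)
  have hT := setIntegral_Ioi_weilArchDensity_le_archTailQ c.Kt hnt h2b0 htail1
  have hDtail : EqOn (fun t ↦ weilArchDensity t * weilIncrement G t) (fun t ↦ 2 * N * weilArchDensity t)
      (Set.Ioi ((2 * b : ℚ) : ℝ)) := fun t ht ↦ by
    simp only
    rw [weilIncrement_polyWitness_eq_of_lt hodd hb0 (by push_cast at ht; exact ht)]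
    ring
  have hintW' : IntegrableOn (fun t ↦ 2 * N * weilArchDensity t) (Set.Ioi ((2 * b : ℚ) : ℝ)) :=
    hintW.const_mul (2 * N)
  have hintT : IntegrableOn (fun t ↦ weilArchDensity t * weilIncrement G t) (Set.Ioi ((2 * b : ℚ) : ℝ)) :=
    hintW'.congr_fun hDtail.symm measurableSet_Ioi
  have hTail : ∫ t in Set.Ioi ((2 * b : ℚ) : ℝ), weilArchDensity t * weilIncrement G t ≤ 2 * N * archTailQ (2 * b) c.Kt c.nt := by
    rw [setIntegral_congr_fun measurableSet_Ioi hDtail, integral_const_mul]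
    exact mul_le_mul_of_nonneg_left hT (by positivity)
  -- the whole half-line
  have hunion : Set.Ioc (0 : ℝ) ((2 * b : ℚ) : ℝ) ∪ Set.Ioi ((2 * b : ℚ) : ℝ) = Set.Ioi (0 : ℝ) :=
    Set.Ioc_union_Ioi_eq_Ioi (by exact_mod_cast h2b0.le)
  have hfin : IntegrableOn (fun t ↦ weilArchDensity t * weilIncrement G t) (Set.Ioi (0 : ℝ)) := by
    rw [← hunion]; exact hintA.union hintT
  have hInt : ∫ t in Set.Ioi (0 : ℝ), weilArchDensity t * weilIncrement G t
      ≤ (evQ (integ (mul (archMajorL c.nA c.mA c.KA) c.q)) (2 * b) : ℝ) + 2 * N * archTailQ (2 * b) c.Kt c.nt := by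
    rw [← hunion, setIntegral_union Ioc_disjoint_Ioi_same measurableSet_Ioi hintA hintT]
    exact add_le_add hA hTail
  -- the polar moment
  have hm := mellinOneLowerQ_le_norm (p := p) hne hb0 (by exact_mod_cast hb1.trans (by norm_num : (1:ℚ) ≤ 2))
  have hm0 : (0 : ℝ) ≤ mellinOneLowerQ p b c.ne := by rw [mellinOneLowerQ]; push_cast; exact le_max_right _ _
  have hpol : (mellinOneLowerQ p b c.ne : ℝ) ^ 2 ≤ ‖weilMellin G 1‖ ^ 2 := pow_le_pow_left₀ hm0 hm 2
  -- assemble the strict inequality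
  have hmain' : (c.lhsQ : ℝ) < c.rhsQ c0 := by exact_mod_cast hmain
  have hlhs : ∫ t in Set.Ioi (0 : ℝ), weilArchDensity t * weilIncrement G t ≤ (c.lhsQ : ℝ) := by
    rw [WeilNegCert0.lhsQ]; push_cast; linarith
  have hrhs : (c.rhsQ c0 : ℝ) ≤ SemilocalMarkov.semilocalEmptyConstant * (∫ x, ‖G x‖ ^ 2) + 2 * ‖weilMellin G 1‖ ^ 2 := by
    rw [WeilNegCert0.rhsQ, hN]; push_cast
    have : (c0 : ℝ) * N ≤ SemilocalMarkov.semilocalEmptyConstant * N := mul_le_mul_of_nonneg_right hc0 hN0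
    linarith
  have hlt : (∫ t in Set.Ioi (0 : ℝ), weilArchDensity t * weilIncrement G t) <
      SemilocalMarkov.semilocalEmptyConstant * (∫ x, ‖G x‖ ^ 2) + 2 * ‖weilMellin G 1‖ ^ 2 :=
    lt_of_le_of_lt hlhs (hmain'.trans_le hrhs)
  exact SemilocalMarkov.weilSemilocalThreshold_empty_le_of_markovWitness hW hfin hlt hblt

/-- Soundness with the sharp constant: `c.check c0SharpQ = true → a*(∅) ≤ c.b`. -/
theorem weilSemilocalThreshold_empty_le_of_check_sharp (c : WeilNegCert0) (h : c.check c0SharpQ = true) :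
    weilSemilocalThreshold ∅ ≤ (c.b : ℝ) :=
  weilSemilocalThreshold_empty_le_of_check c c0SharpQ_le h

/-! ## The instance: `a*(∅) ≤ 3/8` by a cubic, and the class `S ∌ 2` -/

/-- The cubic witness of the A4 table (lineage B, cc-s2-5): `p(x) = (43ξ − 35ξ³)/2`, `ξ = x/b = 8x/3`,
in powers of `x`. -/
def pEmptyCubic : List ℚ := [0, 172 / 3, 0, -8960 / 27]

/-- The certificate: `b = 3/8`, orders `(nA, mA, KA, Kt, nt, ne) = (14, 7, 5, 10, 40, 16)`. -/
def certEmptyCubic : WeilNegCert0 := ⟨pEmptyCubic, 3 / 8, 14, 7, 5, 10, 40, 16⟩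

set_option maxHeartbeats 0 in
/-- The checker accepts `certEmptyCubic` against the sharp constant `c0SharpQ`. -/
theorem check_certEmptyCubic : certEmptyCubic.check c0SharpQ = true := by
  decide +kernel

/-- **`a*(∅) ≤ 3/8`**: the pure archimedean (+ polar) Weil form is negative on a cubic × indicator at window `3/8`. -/
theorem weilSemilocalThreshold_empty_le_three_eighths :
    weilSemilocalThreshold ∅ ≤ ((3 / 8 : ℚ) : ℝ) :=
  weilSemilocalThreshold_empty_le_of_check_sharp certEmptyCubic check_certEmptyCubic

/-- `a*(∅) < (log 3)/2`: the `∅`-threshold sits below the first odd-prime coincidence window. -/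
theorem weilSemilocalThreshold_empty_lt_log_three_half :
    weilSemilocalThreshold ∅ < Real.log 3 / 2 := by
  have h := weilSemilocalThreshold_empty_le_three_eighths
  have h3 : (3 / 4 : ℝ) < Real.log 3 := by
    have := Real.log_three_gt_d9
    linarith
  push_cast at h
  linarith

/-- The degree-9 witness of the A4 table at `b = 3717/10000` (lineage B bottom vector of the Legendre section `d = 9`,
rounded: `p = 10⁵P₁ − 63925P₃ + 941P₅ − 2986P₇ − 2219P₉` in `ξ = x/b`), in powers of `x`; certified margin
`Re Q_∅/‖G‖² = −1.0509…·10⁻⁴` (two exact engines). -/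
def pEmpty03717 : List ℚ :=
  [0, 5299278125 / 9912, 0, -146741093750000000 / 51354402813, 0, -278757812500000000000000 / 11262174600099339, 0,
    1220549687500000000000000000000000 / 3267583338778749405768591, 0,
    -30102617187500000000000000000000000000000 / 19347952381493294185198271425971]

/-- The certificate at `b = 0.3717`: orders `(nA, mA, KA, Kt, nt, ne) = (14, 7, 5, 10, 40, 16)`. -/
def certEmpty03717 : WeilNegCert0 := ⟨pEmpty03717, 3717 / 10000, 14, 7, 5, 10, 40, 16⟩

set_option maxHeartbeats 0 in
/-- The checker accepts `certEmpty03717` against `c0SharpQ`. -/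
theorem check_certEmpty03717 : certEmpty03717.check c0SharpQ = true := by
  decide +kernel

/-- **`a*(∅) ≤ 0.3717`** — within `1.1·10⁻⁴` of the two-lineage DATA value `a*(∅) = 0.37160` of the A4 table. -/
theorem weilSemilocalThreshold_empty_le_03717 :
    weilSemilocalThreshold ∅ ≤ ((3717 / 10000 : ℚ) : ℝ) :=
  weilSemilocalThreshold_empty_le_of_check_sharp certEmpty03717 check_certEmpty03717

/-- **The class `S ∌ 2`** (rows `{∞}`, `{∞,3}`, `{∞,5}`, `{∞,3,5}`, … of the A4 table): `a*(S) = a*(∅)`. -/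
theorem weilSemilocalThreshold_eq_empty_of_two_not_mem {S : Finset ℕ} (h2 : 2 ∉ S) :
    weilSemilocalThreshold S = weilSemilocalThreshold ∅ := by
  refine weilSemilocalThreshold_congr (S := ∅) (S' := S) (N := 2) ?_ ?_
  · intro n hn hpp
    have hn2 : n = 2 := by
      rcases hpp.two_le.eq_or_lt with h | h
      · exact h.symm
      · omega
    subst hn2
    rw [Nat.prime_two.primeFactors]
    simp [h2]
  · have h := weilSemilocalThreshold_empty_lt_log_three_half
    norm_num
    exact h

/-- **`a*(S) ≤ 3/8` for every finite set of primes `S ∌ 2`.** -/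
theorem weilSemilocalThreshold_le_three_eighths_of_two_not_mem {S : Finset ℕ} (h2 : 2 ∉ S) :
    weilSemilocalThreshold S ≤ ((3 / 8 : ℚ) : ℝ) := by
  rw [weilSemilocalThreshold_eq_empty_of_two_not_mem h2]
  exact weilSemilocalThreshold_empty_le_three_eighths

/-- **`a*(S) ≤ 0.3717` for every finite set of primes `S ∌ 2`.** -/
theorem weilSemilocalThreshold_le_03717_of_two_not_mem {S : Finset ℕ} (h2 : 2 ∉ S) :
    weilSemilocalThreshold S ≤ ((3717 / 10000 : ℚ) : ℝ) := by
  rw [weilSemilocalThreshold_eq_empty_of_two_not_mem h2]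
  exact weilSemilocalThreshold_empty_le_03717

/-- **The bracket of the class `S ∌ 2`**: `(log 2)/2 ≤ a*(S) ≤ 0.3717` (`0.34657 ≤ a*(S) ≤ 0.3717`; DATA: `0.37160`). -/
theorem weilSemilocalThreshold_mem_Icc_of_two_not_mem {S : Finset ℕ} (h2 : 2 ∉ S) :
    weilSemilocalThreshold S ∈ Set.Icc (Real.log 2 / 2) ((3717 / 10000 : ℚ) : ℝ) :=
  ⟨log_two_half_le_weilSemilocalThreshold S, weilSemilocalThreshold_le_03717_of_two_not_mem h2⟩

end Summit.RiemannHypothesis.RiemannHypothesis.Theorems.SemilocalPolyWitness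

end
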